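import Summits.PneNP.PneNP.Theses.RootDecompMcspReach
import Summits.PneNP.PneNP.Theorems.RootDecompMcspReachReachMachinery

/-!
# `RootDecompMcspReach.ReachLiftAC0Costume` (stmt-PneNP-32190) — the bottom cell of the reach dial is costume

Node N41 (route `route-PneNP-RootDecompMcspReach`, lens-3 g9): the reach dial `ReachHard 𝒞` («every
language of `𝒞` reduces to exact MCSP under non-uniform constant-depth `acBasis`-reductions») is DECIDED
at the bottom `𝒞 = AC⁰` — every `AC⁰` language reduces to MCSP by the TWIN trick (MCSP has a yes- and a
no-instance of equal length; map `x ↦ y₁ / y₀` through the `AC⁰` indicator of the language) — so the lift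
piece of the bottom cell, «(ReachHard AC⁰ → S)», is EQUIVALENT to `S`: COSTUME BY THEOREM (the BC5
record of the route).  Port of the lens kernel `reachLift_AC0_iff` / `reachHard_AC0`
(writer pack `reachLiftAC0Costume_holds`).  0 sorry.
-/

namespace Summit.PneNP.PneNP.Theorems

open Literature.Computability.Complexity Literature.Computability.MetaComplexity

/-- The bottom cell's lift is costume (stmt-PneNP-32190, `ReachLiftAC0Costume`):
`((∀ L ∈ AC⁰, L ≤ MCSP by non-uniform AC⁰ reductions) → PneNP) ↔ PneNP`, since the hypothesis is a
THEOREM (`RootDecompMcspReachPort.cdRed_of_mem_cdp` with the twin pair `hasTwin_MCSP`).  Port of the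
lens-3 g9 kernel `reachLift_AC0_iff` (decomp-pnenp cell, 2026-08-30). -/
theorem reachLiftAC0Costume_proof :
    Summit.PneNP.PneNP.Theses.RootDecompMcspReach.ReachLiftAC0Costume := by
  unfold Summit.PneNP.PneNP.Theses.RootDecompMcspReach.ReachLiftAC0Costume
  refine ⟨fun h => h fun L hL => ?_, fun hS _ => hS⟩
  exact RootDecompMcspReachPort.cdRed_of_mem_cdp (B := acBasis) subset_rfl hL
    RootDecompMcspReachPort.hasTwin_MCSP

end Summit.PneNP.PneNP.Theorems
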